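import Summits.ResolutionOfSingularities.ResolutionOfSingularities.Theorems.PurelyInseparableDim4ResConeLayerBirths
import HarnessLib
import HarnessLib.Audit.Tags

/-!
# Purely inseparable four-folds — WITNESS SURVIVAL UNDER A TRANSLATED POINT STEP: the cancellers of a monomial, the
# coefficient of the principal image of a canceller-free («≺-maximal») monomial, and maximal axis witnesses
# (cell `res-dim4-pi`, K2(p) lane, ROW B-LOSSY kernel vocabulary; every `q`, every chart point)

[OURS · counted 0 · cell `res-dim4-pi` · K2(p) lane holder res-dim4-p-12 g5 (e = 3 map 13:55Z: «B-LOSSY (lossy T-sector) — no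
mechanism»); the TEXT is res-dim4-p-7 g6's «axis deficits under a translated step» (bus 2026-08-29T13:54:34Z (2)(3), datum
`transstep_check` 3e6d51b51673cc1b: 14,400 / 13,847 agreements) — this file is its COEFFICIENT half; the SUPPORT half (source law
`exists_source_of_mem_support_step_kept`, p719846) is res-dim4-p-5 g6's; seat res-dim4-p-11 g6.]  Nothing here proves any
TAIL(p, d, 3), K2(7), K2(p), `NoIsolatedTrap p p` or resolution of singularities in dimension ≥ 4 / characteristic `p` — NOT proved;
pure bookkeeping of ONE step `CentreBlowup.step q univ j b` of OUR frame.  AI kernel work, weaker than expert review.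

ONE POINT STEP in the `x_j`-chart at the chart point `b` (`b_j = 0`; translated letters `S = {i : b_i ≠ 0}`), `q ≤ ord F`.  The child is
`deletePthPowers q (chartTransform (shear j b F))` (`step_F_eq_deletePthPowers_chartTransform_shear`), and the coefficient of the chart
image `x^{E′}`, `E′ = chartExponent q univ j E = E.update j (|E| − q)`, is `coeff_E (shear j b F)` unless `E′` is a `q`-th power
(`coeff_step_F_chartExponent`, res-dim4-p-5 g3).  The **cancellers** of `E` are the multidegrees `m ≠ E` with `|m| = |E|`, `m_i = E_i`
for every untranslated `i ≠ j` and `m_i ≥ E_i` for every translated `i` (so `m = E + t − |t|·e_j`, `t ≠ 0` supported on `S`,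
`|t| ≤ E_j`: mass moved from the chart letter to the translated letters); write `E ≼ m` for «`m = E` or a canceller of `E`».
* §1 `apply_le_of_mem_support_shear_monomial` (`μ ∈ supp shear(x^m)`, `i ≠ j` ⇒ `μ_i ≤ m_i`), `preceq_of_mem_support_shear_monomial`
  (every monomial `μ` of `shear(x^m)` has `μ ≼ m`), `coeff_self_shear_monomial` (`coeff_m shear(x^m) = 1`).
* §2 **`coeff_shear_eq_of_forall_not_canceller`** — if no canceller of `E` lies in `supp F` then `coeff_E (shear j b F) = coeff_E F`;
  **`coeff_step_chartExponent_of_forall_not_canceller`** — hence the child coefficient at `E′` is `coeff_E F` exactly (or `0` if `E′` is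
  a `q`-th power, deleted by the cleaning); `chartExponent_mem_support_step_of_forall_not_canceller`.
* §3 **`exists_maximal_canceller_free`** — above every `E ∈ supp F` there is an `m ∈ supp F`, `E ≼ m`, with NO canceller in `supp F`
  (finite support); `offDegree_le_of_preceq` — for a letter `l ≠ j` the off-`l` degree `|m| − m_l` does not increase along `≼`
  (equal if `l` is untranslated, smaller by the transferred mass if `l` is translated); hence **`exists_surviving_axis_witness`**: if
  `x^E ∈ supp F` has off-`l` degree `≤ N` (`l ≠ j`; `N = q − 1`: an `l`-AXIS WITNESS), some `x^m ∈ supp F` with off-`l` degree `≤ N`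
  has its principal image in the child with coefficient `coeff_m F` — it SURVIVES unless it is a `q`-th power.  This is the
  lower-bound direction the support-level source law cannot give; at a pure step (`b = 0`) every monomial is canceller-free.
[cite: Hauser2010, §§F–G, §I (P⁺ = P(y + t·y_m))] [cite: HauserPerlega2019PRIMS, §2 (transform at a translated point)]
bears_on: LADDER-RESOLUTION:D157-DOOR2 (res-dim4-pi · K2(p) · B-LOSSY kernel vocabulary · translated-step witness survival).
Supports stmt-ResolutionOfSingularities-16155 (helper).
-/

set_option linter.dupNamespace false -- mandated namespace of this single-conjunct summit

noncomputable section

namespace Summit.ResolutionOfSingularities.ResolutionOfSingularities.Theorems.PIDim4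

namespace ResCone

open MvPolynomial Finset
open Literature.AlgebraicGeometry.Resolution
open Literature.AlgebraicGeometry.Resolution.CentreBlowup
open Literature.AlgebraicGeometry.Resolution.Hauser2010
open Literature.AlgebraicGeometry.Resolution.HauserPerlega2019

variable {K : Type} [Field K]

/-! ## 1. The monomials of `shear j b (x^m)`: upper bounds off the chart letter, the diagonal coefficient -/

section ShearMonomial

variable [DecidableEq K]

omit [DecidableEq K] in
/-- `degreeOf i` of a sheared variable for `i ≠ j`: `1` for `x_i` itself, `0` for every other variable. [folklore]
[cite: Hauser2010, §I (definition of P⁺)] -/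
theorem degreeOf_shear_X_of_ne (j : Fin 4) {i : Fin 4} (hij : i ≠ j) (b : Fin 4 → K) (k : Fin 4) :
    degreeOf i (shear j b (X k : MvPolynomial (Fin 4) K)) ≤ if k = i then 1 else 0 := by
  by_cases hkj : k = j
  · subst hkj
    rw [shear_X_self, degreeOf_X, if_neg hij, if_neg (Ne.symm hij)]
  · rw [shear_X_of_ne hkj]
    refine (degreeOf_add_le _ _ _).trans (max_le ?_ ?_)
    · rw [degreeOf_X]
      by_cases hik : i = k
      · subst hik; simp
      · rw [if_neg hik]; exact Nat.zero_le _
    · refine (degreeOf_C_mul_le _ _ _).trans ?_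
      rw [degreeOf_X, if_neg hij]
      exact Nat.zero_le _

omit [DecidableEq K] in
/-- **Off the chart letter a shear only LOSES mass**: `degreeOf i (shear j b (c·x^m)) ≤ m_i` for `i ≠ j`. [folklore]
[cite: Hauser2010, §I (definition of P⁺)] -/
theorem degreeOf_shear_monomial_le_of_ne (j : Fin 4) {i : Fin 4} (hij : i ≠ j) (b : Fin 4 → K) (m : Fin 4 →₀ ℕ)
    (c : K) : degreeOf i (shear j b (monomial m c)) ≤ m i := by
  classical
  rw [monomial_eq, Finsupp.prod_fintype _ _ (fun i => pow_zero _)]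
  have hmul : shear j b (C c * ∏ k, (X k : MvPolynomial (Fin 4) K) ^ m k) = C c * ∏ k, shear j b (X k) ^ m k := by
    unfold shear
    rw [map_mul, map_prod, algHom_C, MvPolynomial.algebraMap_eq]
    simp_rw [map_pow]
  rw [hmul]
  refine (degreeOf_C_mul_le _ _ _).trans ((degreeOf_prod_le _ _ _).trans ?_)
  calc ∑ k, degreeOf i (shear j b (X k : MvPolynomial (Fin 4) K) ^ m k)
      ≤ ∑ k, m k * (if k = i then 1 else 0) :=
        Finset.sum_le_sum fun k _ => (degreeOf_pow_le _ _ _).trans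
          (Nat.mul_le_mul_left _ (degreeOf_shear_X_of_ne j hij b k))
    _ = m i := by simp

omit [DecidableEq K] in
/-- Every monomial `x^μ` of `shear j b (c·x^m)` has `μ_i ≤ m_i` for every `i ≠ j`. [folklore]
[cite: Hauser2010, §I (definition of P⁺)] -/
theorem apply_le_of_mem_support_shear_monomial (j : Fin 4) (b : Fin 4 → K) (m : Fin 4 →₀ ℕ) (c : K)
    {μ : Fin 4 →₀ ℕ} (hμ : μ ∈ (shear j b (monomial m c)).support) {i : Fin 4} (hij : i ≠ j) : μ i ≤ m i :=
  (monomial_le_degreeOf i hμ).trans (degreeOf_shear_monomial_le_of_ne j hij b m c)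

omit [DecidableEq K] in
/-- Every monomial `x^μ` of `shear j b (c·x^m)` has total degree `|m|`. [folklore] [cite: Hauser2010, §I (definition of P⁺)] -/
theorem degree_eq_of_mem_support_shear_monomial (j : Fin 4) (b : Fin 4 → K) (m : Fin 4 →₀ ℕ) (c : K)
    {μ : Fin 4 →₀ ℕ} (hμ : μ ∈ (shear j b (monomial m c)).support) : μ.degree = m.degree := by
  have h := Straightening.isHomogeneous_shear_monomial j b m c (MvPolynomial.mem_support_iff.mp hμ)
  rwa [weight_one_eq_degree] at h

/-- **Every monomial of `shear j b (x^m)` lies BELOW `m` in the canceller order** (`b_j = 0`): `|μ| = |m|`, `μ_i = m_i` for every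
untranslated `i ≠ j`, `μ_i ≤ m_i` for every `i ≠ j` — i.e. `m = μ + t − |t|·e_j` with `t ≥ 0` supported on the translated letters.
[folklore] [cite: Hauser2010, §I (definition of P⁺)] -/
theorem preceq_of_mem_support_shear_monomial (j : Fin 4) {b : Fin 4 → K} (hbj : b j = 0) (m : Fin 4 →₀ ℕ)
    {μ : Fin 4 →₀ ℕ} (hμ : μ ∈ (shear j b (monomial m (1 : K))).support) :
    μ.degree = m.degree ∧ (∀ i, i ≠ j → b i = 0 → m i = μ i) ∧ (∀ i, i ≠ j → μ i ≤ m i) := by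
  refine ⟨degree_eq_of_mem_support_shear_monomial j b m 1 hμ, fun i hij hbi => ?_,
    fun i hij => apply_le_of_mem_support_shear_monomial j b m 1 hμ hij⟩
  have hle := le_of_mem_support_shear_monomial j hbj m hμ i
  rw [filter_apply_eq, if_pos hbi] at hle
  exact le_antisymm hle (apply_le_of_mem_support_shear_monomial j b m 1 hμ hij)

/-- Every monomial of `shear j b (x^m)` (`b_j = 0`) has `x_j`-exponent at least `m_j`. [folklore]
[cite: Hauser2010, §I (definition of P⁺)] -/
theorem apply_self_le_of_mem_support_shear_monomial (j : Fin 4) {b : Fin 4 → K} (hbj : b j = 0) (m : Fin 4 →₀ ℕ)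
    {μ : Fin 4 →₀ ℕ} (hμ : μ ∈ (shear j b (monomial m (1 : K))).support) : m j ≤ μ j := by
  have hle := le_of_mem_support_shear_monomial j hbj m hμ j
  rwa [filter_apply_eq, if_pos hbj] at hle

/-- **The diagonal coefficient of a sheared monomial is `1`**: `coeff_m (shear j b (x^m)) = 1` (`b_j = 0`) — the `t = 0` term of the
multinomial expansion of `∏ (x_i + b_i x_j)^{m_i}`. [folklore] [cite: Hauser2010, §I (definition of P⁺)] -/
theorem coeff_self_shear_monomial (j : Fin 4) {b : Fin 4 → K} (hbj : b j = 0) (m : Fin 4 →₀ ℕ) :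
    coeff m (shear j b (monomial m (1 : K))) = 1 := by
  classical
  induction hn : m.degree generalizing m with
  | zero =>
    have hm : m = 0 := (Finsupp.degree_eq_zero_iff m).mp hn
    subst hm
    have h1 : shear j b (monomial (0 : Fin 4 →₀ ℕ) (1 : K)) = 1 := by
      rw [show monomial (0 : Fin 4 →₀ ℕ) (1 : K) = C 1 from rfl, C_1]
      unfold shear
      rw [map_one]
    rw [h1, show (1 : MvPolynomial (Fin 4) K) = monomial 0 1 from rfl, coeff_monomial, if_pos rfl]
  | succ n ih =>
    -- split off one variable: `m = m' + e_k`
    have hm0 : m ≠ 0 := by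
      intro h; rw [h, map_zero] at hn; exact Nat.succ_ne_zero n hn.symm
    obtain ⟨k, hk⟩ := Finsupp.ne_iff.mp hm0
    rw [Finsupp.coe_zero, Pi.zero_apply] at hk
    obtain ⟨m', hmk⟩ : ∃ m' : Fin 4 →₀ ℕ, m = m' + Finsupp.single k 1 :=
      ⟨m - Finsupp.single k 1,
        (tsub_add_cancel_of_le (Finsupp.single_le_iff.mpr (Nat.one_le_iff_ne_zero.mpr hk))).symm⟩
    have hsub : m - Finsupp.single k 1 = m' := by rw [hmk, add_tsub_cancel_right]
    have hdeg' : m'.degree = n := by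
      have h := congrArg Finsupp.degree hmk
      rw [map_add, Finsupp.degree_single] at h
      omega
    have ih' := ih m' hdeg'
    have hsplit : monomial m (1 : K) = monomial m' 1 * X k := by
      rw [X, monomial_mul, mul_one, ← hmk]
    have hmul : shear j b (monomial m (1 : K)) = shear j b (monomial m' 1) * shear j b (X k) := by
      rw [hsplit]; unfold shear; rw [map_mul]
    rw [hmul]
    by_cases hkj : k = j
    · subst hkj
      rw [shear_X_self, coeff_mul_X', if_pos (Finsupp.mem_support_iff.mpr hk), hsub, ih']
    · rw [shear_X_of_ne hkj, mul_add, coeff_add, coeff_mul_X', if_pos (Finsupp.mem_support_iff.mpr hk), hsub, ih',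
        ← mul_assoc, mul_comm (shear j b _) (C (b k)), mul_assoc, coeff_C_mul, coeff_mul_X']
      -- the second term vanishes: `(m − e_j)_j < m'_j ≤ μ_j` for every monomial `μ` of `shear (x^{m'})`
      suffices h : coeff (m - Finsupp.single j 1) (shear j b (monomial m' (1 : K))) = 0 by
        rw [h]; split_ifs <;> simp
      by_contra hne
      have hμ := apply_self_le_of_mem_support_shear_monomial j hbj m' (MvPolynomial.mem_support_iff.mpr hne)
      have hmj : m j = m' j := by
        rw [hmk, Finsupp.add_apply, Finsupp.single_eq_of_ne (Ne.symm hkj), add_zero]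
      have hμj : (m - Finsupp.single j 1 : Fin 4 →₀ ℕ) j = m j - 1 := by
        rw [Finsupp.tsub_apply, Finsupp.single_eq_same]
      rw [hμj] at hμ
      by_cases hmj0 : m j = 0
      · -- degree mismatch: `|m − e_j| = |m| = n + 1 ≠ n = |m'|`
        have hdeg := degree_eq_of_mem_support_shear_monomial j b m' 1 (MvPolynomial.mem_support_iff.mpr hne)
        have hsubj : m - Finsupp.single j 1 = m := by
          ext i
          rw [Finsupp.tsub_apply]
          by_cases hij : i = j
          · subst hij; rw [hmj0, Finsupp.single_eq_same, Nat.zero_sub]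
          · rw [Finsupp.single_eq_of_ne hij, Nat.sub_zero]
        rw [hsubj, hn, hdeg'] at hdeg
        omega
      · omega

end ShearMonomial

/-! ## 2. Canceller-free monomials: the principal image keeps its coefficient -/

section Canceller

variable [DecidableEq K]

/-- **A CANCELLER-FREE MONOMIAL KEEPS ITS COEFFICIENT UNDER THE SHEAR.**  If no `m ∈ supp F` other than `E` has `|m| = |E|`,
`m_i = E_i` for every untranslated `i ≠ j` and `m_i ≥ E_i` for every `i ≠ j` (no CANCELLER `E + t − |t|·e_j`, `t ≠ 0` on the
translated letters), then `coeff_E (shear j b F) = coeff_E F`. [OURS · bookkeeping] [cite: Hauser2010, §I (definition of P⁺)] -/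
theorem coeff_shear_eq_of_forall_not_canceller (j : Fin 4) {b : Fin 4 → K} (hbj : b j = 0) (F : MvPolynomial (Fin 4) K)
    (E : Fin 4 →₀ ℕ)
    (hmax : ∀ m ∈ F.support, m.degree = E.degree → (∀ i, i ≠ j → b i = 0 → m i = E i) → (∀ i, i ≠ j → E i ≤ m i) → m = E) :
    coeff E (shear j b F) = coeff E F := by
  classical
  have hF : shear j b F = ∑ m ∈ F.support, C (coeff m F) * shear j b (monomial m (1 : K)) := by
    conv_lhs => rw [F.as_sum]
    unfold shear
    rw [map_sum]
    refine Finset.sum_congr rfl fun m _ => ?_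
    rw [← mul_one (coeff m F), ← C_mul_monomial, map_mul, aeval_C, mul_one]
    rfl
  rw [hF, coeff_sum]
  simp_rw [coeff_C_mul]
  by_cases hE : E ∈ F.support
  · rw [← Finset.add_sum_erase _ _ hE, coeff_self_shear_monomial j hbj E, mul_one, Finset.sum_eq_zero, add_zero]
    intro m hm
    obtain ⟨hmE, hmF⟩ := Finset.mem_erase.mp hm
    suffices h : coeff E (shear j b (monomial m (1 : K))) = 0 by rw [h, mul_zero]
    by_contra hne
    obtain ⟨hdeg, hkept, hle⟩ := preceq_of_mem_support_shear_monomial j hbj m (MvPolynomial.mem_support_iff.mpr hne)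
    exact hmE (hmax m hmF hdeg.symm hkept hle)
  · rw [MvPolynomial.notMem_support_iff.mp hE, Finset.sum_eq_zero]
    intro m hmF
    suffices h : coeff E (shear j b (monomial m (1 : K))) = 0 by rw [h, mul_zero]
    by_contra hne
    obtain ⟨hdeg, hkept, hle⟩ := preceq_of_mem_support_shear_monomial j hbj m (MvPolynomial.mem_support_iff.mpr hne)
    exact hE (hmax m hmF hdeg.symm hkept hle ▸ hmF)

/-- **THE PRINCIPAL IMAGE OF A CANCELLER-FREE MONOMIAL** (one point step, chart `x_j`, chart point `b`, `b_j = 0`, `q ≤ ord F`,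
`q ≤ |E|`): the child coefficient at `E′ = chartExponent q univ j E` is `coeff_E F` exactly — or `0` if `E′` is a `q`-th power
exponent (deleted by the cleaning). [OURS · bookkeeping] [cite: HauserPerlega2019PRIMS, §2 (transform at a translated point)]
[cite: Hauser2010, §§F–G, §I] -/
theorem coeff_step_chartExponent_of_forall_not_canceller (q : ℕ) (j : Fin 4) {b : Fin 4 → K} (hbj : b j = 0) (s : State K)
    (hq : (q : ℕ∞) ≤ ordAlong Finset.univ s.F) {E : Fin 4 →₀ ℕ} (hE : q ≤ E.degree)
    (hmax : ∀ m ∈ s.F.support, m.degree = E.degree → (∀ i, i ≠ j → b i = 0 → m i = E i) → (∀ i, i ≠ j → E i ≤ m i) →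
      m = E) :
    coeff (chartExponent q Finset.univ j E) (CentreBlowup.step q Finset.univ j b s).F =
      if IsPthPowerExponent q (chartExponent q Finset.univ j E) then 0 else coeff E s.F := by
  rw [coeff_step_F_chartExponent q j hbj s hq hE, coeff_shear_eq_of_forall_not_canceller j hbj s.F E hmax]

/-- **A canceller-free monomial of `F` SURVIVES the step** (its principal image is a monomial of the child) unless the image is a
`q`-th power exponent. [OURS · bookkeeping] [cite: HauserPerlega2019PRIMS, §2 (transform at a translated point)] -/
theorem chartExponent_mem_support_step_of_forall_not_canceller (q : ℕ) (j : Fin 4) {b : Fin 4 → K} (hbj : b j = 0)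
    (s : State K) (hq : (q : ℕ∞) ≤ ordAlong Finset.univ s.F) {E : Fin 4 →₀ ℕ} (hEF : E ∈ s.F.support) (hE : q ≤ E.degree)
    (hmax : ∀ m ∈ s.F.support, m.degree = E.degree → (∀ i, i ≠ j → b i = 0 → m i = E i) → (∀ i, i ≠ j → E i ≤ m i) →
      m = E)
    (hnp : ¬ IsPthPowerExponent q (chartExponent q Finset.univ j E)) :
    chartExponent q Finset.univ j E ∈ (CentreBlowup.step q Finset.univ j b s).F.support := by
  rw [MvPolynomial.mem_support_iff, coeff_step_chartExponent_of_forall_not_canceller q j hbj s hq hE hmax, if_neg hnp]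
  exact MvPolynomial.mem_support_iff.mp hEF

omit [DecidableEq K] in
/-- At a PURE step (`b = 0`) every monomial is canceller-free: the canceller conditions force `m = E`. [folklore] -/
theorem eq_of_preceq_of_pure (j : Fin 4) {m E : Fin 4 →₀ ℕ} (hdeg : m.degree = E.degree)
    (hkept : ∀ i, i ≠ j → (0 : Fin 4 → K) i = 0 → m i = E i) : m = E := by
  have hoff : ∀ i, i ≠ j → m i = E i := fun i hij => hkept i hij rfl
  ext i
  by_cases hij : i = j
  · subst hij
    have hm := Finsupp.degree_eq_sum m
    have hEs := Finsupp.degree_eq_sum E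
    rw [← Finset.add_sum_erase _ _ (Finset.mem_univ i)] at hm hEs
    have hrest : ∑ x ∈ Finset.univ.erase i, m x = ∑ x ∈ Finset.univ.erase i, E x :=
      Finset.sum_congr rfl fun x hx => hoff x (Finset.ne_of_mem_erase hx)
    omega
  · exact hoff i hij

end Canceller

/-! ## 3. Maximal canceller-free monomials above a given one; axis witnesses move up -/

section Maximal

variable [DecidableEq K]

/-- **ABOVE EVERY MONOMIAL OF `F` THERE IS A CANCELLER-FREE ONE** (finite support): some `m ∈ supp F` with `E ≼ m` (`|m| = |E|`,
`m = E` on the untranslated letters `≠ j`, `m ≥ E` off `j`) has no canceller in `supp F`.  Proof: maximise the off-`j` mass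
`|m| − m_j` over the monomials of `F` above `E`. [OURS · bookkeeping] [cite: Hauser2010, §I (definition of P⁺)] -/
theorem exists_maximal_canceller_free (j : Fin 4) (b : Fin 4 → K) (F : MvPolynomial (Fin 4) K) {E : Fin 4 →₀ ℕ}
    (hE : E ∈ F.support) :
    ∃ m ∈ F.support, (m.degree = E.degree ∧ (∀ i, i ≠ j → b i = 0 → m i = E i) ∧ (∀ i, i ≠ j → E i ≤ m i)) ∧
      ∀ m' ∈ F.support, m'.degree = m.degree → (∀ i, i ≠ j → b i = 0 → m' i = m i) → (∀ i, i ≠ j → m i ≤ m' i) →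
        m' = m := by
  classical
  -- the monomials of `F` above `E`
  set A : Finset (Fin 4 →₀ ℕ) := F.support.filter fun m =>
    m.degree = E.degree ∧ (∀ i, i ≠ j → b i = 0 → m i = E i) ∧ (∀ i, i ≠ j → E i ≤ m i) with hA
  have hEA : E ∈ A := Finset.mem_filter.mpr ⟨hE, rfl, fun _ _ _ => rfl, fun _ _ => le_rfl⟩
  -- maximise the off-`j` mass `Σ_{i ≠ j} m i`
  obtain ⟨m, hmA, hmmax⟩ := Finset.exists_max_image A (fun m => ∑ i ∈ Finset.univ.erase j, m i) ⟨E, hEA⟩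
  obtain ⟨hmF, hmdeg, hmkept, hmle⟩ := Finset.mem_filter.mp hmA
  refine ⟨m, hmF, ⟨hmdeg, hmkept, hmle⟩, fun m' hm'F hdeg' hkept' hle' => ?_⟩
  have hm'A : m' ∈ A := by
    refine Finset.mem_filter.mpr ⟨hm'F, hdeg'.trans hmdeg, fun i hij hbi => (hkept' i hij hbi).trans (hmkept i hij hbi),
      fun i hij => (hmle i hij).trans (hle' i hij)⟩
  have hsum := hmmax m' hm'A
  -- `m ≤ m'` off `j` with `Σ_{i ≠ j} m' ≤ Σ_{i ≠ j} m` forces equality off `j`, and equal degrees give equality at `j`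
  have hoff : ∀ i ∈ Finset.univ.erase j, m' i = m i := by
    have hle : ∀ i ∈ Finset.univ.erase j, m i ≤ m' i := fun i hi => hle' i (Finset.ne_of_mem_erase hi)
    have heq : ∑ i ∈ Finset.univ.erase j, m' i = ∑ i ∈ Finset.univ.erase j, m i :=
      le_antisymm hsum (Finset.sum_le_sum hle)
    exact fun i hi => ((Finset.sum_eq_sum_iff_of_le hle).mp heq.symm i hi).symm
  ext i
  by_cases hij : i = j
  · subst hij
    have hm := Finsupp.degree_eq_sum m
    have hm' := Finsupp.degree_eq_sum m'
    rw [← Finset.add_sum_erase _ _ (Finset.mem_univ i)] at hm hm'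
    have hrest : ∑ x ∈ Finset.univ.erase i, m' x = ∑ x ∈ Finset.univ.erase i, m x := Finset.sum_congr rfl hoff
    omega
  · exact hoff i (Finset.mem_erase.mpr ⟨hij, Finset.mem_univ i⟩)

/-- **AXIS WITNESSES MOVE UP**: along the canceller order the off-`l` degree `|m| − m_l` of a letter `l ≠ j` does not increase
(`|m| = |E|` and `m_l ≥ E_l`). [OURS · bookkeeping] [cite: Hauser2010, §I (definition of P⁺)] -/
theorem offDegree_le_of_preceq (j : Fin 4) {l : Fin 4} (hlj : l ≠ j) {E m : Fin 4 →₀ ℕ} (hdeg : m.degree = E.degree)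
    (hle : ∀ i, i ≠ j → E i ≤ m i) : m.degree - m l ≤ E.degree - E l := by
  have h := hle l hlj
  omega

/-- **AT EVERY TRANSLATED STEP EVERY AXIS `l ≠ j` HAS A SURVIVING WITNESS.**  One point step, chart `x_j`, chart point `b`
(`b_j = 0`), `q ≤ ord F`: if some monomial `x^E` of `F` has off-`l` degree `|E| − E_l ≤ N` (`l ≠ j`), then some monomial `x^m` of
`F` with off-`l` degree `≤ N` (and `|m| = |E|`, `m ≥ E` off `j`, `m = E` on the untranslated letters) is canceller-free, so its
principal image `chartExponent q univ j m` carries the coefficient `coeff_m F ≠ 0` in the child — a monomial of the child unless it is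
a `q`-th power exponent.  (`N = q − 1`: `x^E` witnesses that the `x_l`-axis is not `q`-fold for `F`; the deficit bookkeeping of the
image is the consumer's.) [OURS · bookkeeping]
[cite: HauserPerlega2019PRIMS, §2 (transform at a translated point)] [cite: Hauser2010, §§F–G, §I] -/
theorem exists_surviving_axis_witness (q : ℕ) (j : Fin 4) {b : Fin 4 → K} (hbj : b j = 0) (s : State K)
    (hq : (q : ℕ∞) ≤ ordAlong Finset.univ s.F) {l : Fin 4} (hlj : l ≠ j) {E : Fin 4 →₀ ℕ} (hEF : E ∈ s.F.support)
    {N : ℕ} (hN : E.degree - E l ≤ N) :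
    ∃ m ∈ s.F.support, m.degree = E.degree ∧ (∀ i, i ≠ j → b i = 0 → m i = E i) ∧ (∀ i, i ≠ j → E i ≤ m i) ∧
      m.degree - m l ≤ N ∧
      coeff (chartExponent q Finset.univ j m) (CentreBlowup.step q Finset.univ j b s).F =
        if IsPthPowerExponent q (chartExponent q Finset.univ j m) then 0 else coeff m s.F := by
  obtain ⟨m, hmF, ⟨hdeg, hkept, hle⟩, hmax⟩ := exists_maximal_canceller_free j b s.F hEF
  have hqE : q ≤ E.degree := by
    have h := Finset.inf_le (f := fun d => (degIn Finset.univ d : ℕ∞)) hEF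
    rw [degIn_univ] at h
    exact_mod_cast hq.trans h
  refine ⟨m, hmF, hdeg, hkept, hle, (offDegree_le_of_preceq j hlj hdeg hle).trans hN, ?_⟩
  exact coeff_step_chartExponent_of_forall_not_canceller q j hbj s hq (hdeg ▸ hqE) hmax

end Maximal

end ResCone

end Summit.ResolutionOfSingularities.ResolutionOfSingularities.Theorems.PIDim4

end
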